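import Summits.BirchSwinnertonDyer.BirchSwinnertonDyer.Theorems.ShadowIsolationSelmerRankUBGreenbergSplit
import Summits.BirchSwinnertonDyer.BirchSwinnertonDyer.Theorems.TangentConeSelmerRankSmallImageReduction
import Literature.NumberTheory.EllipticCurves.BSDSelmerCMPConverseKLevelProofs
import Literature.NumberTheory.EllipticCurves.LFunctionSmulProofs
import Literature.NumberTheory.EllipticCurves.HeegnerPointsKolyvaginExceptionalTwistProofs
import Literature.NumberTheory.EllipticCurves.GlobalMinimalModelProofs
import Literature.NumberTheory.EllipticCurves.VariableChangePoints
import HarnessLib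

/-!
# BirchSwinnertonDyer / ShadowIsolation — crux `SelmerRankUB` (stmt-BirchSwinnertonDyer-0130),
# line `greenberg-split`: the residual stub is EXACTLY "no excess rank on non-CM curves"

Line `greenberg-split` reduces the crux `SelmerRankUB` (`corank_{ℤ_p} Sel_{p^∞}(E/ℚ) ≤ ord_{s=1}
L(E,s)` at a big-image good ordinary `p ≥ 5`) to three registered stubs; modulo the GZK cell and the
Ш-half it is EQUIVALENT to the rank stub `stub_noExcessRankBigImage` (landed:
`selmerRankUB_iff_noExcessRankBigImage`). That stub still speaks of a prime `p` (good, ordinary,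
`ρ̄_{E,p}` surjective) and of a globally minimal model, although its conclusion `rank ≤ r_an` mentions
neither. This file removes the decoration, sorry-free over PROVED tree theorems:

* `noExcessRankBigImage_iff_noExcessRankNonCM` — the stub is EQUIVALENT to the prime-free,
  model-free statement

    `NoExcessRankNonCM :  ∀ W/ℚ elliptic, ¬ CM → 2 ≤ r_an → rank E(ℚ) ≤ r_an`,

  i.e. the sibling crux `Squeeze.SqueezeUB` (stmt-0496 / 0145, `∀ W, rank ≤ r_an`) RESTRICTED to
  non-CM curves of analytic rank `≥ 2`. (⇒) a non-CM curve has a big-image good ordinary prime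
  `p ≥ 5` — Serre's open image theorem `serre_open_image_holds` and the infinitude of good ordinary
  primes `infinite_goodOrdinaryPrimes_holds`, both PROVED in the tree
  (`exists_goodOrdinary_surjective_of_not_hasCM`) — after passing to a global minimal model
  (`hasGlobalMinimalModel_rat_holds`), along which `rank`, `r_an` and `CM` are invariant
  (`VariableChange.finrank_point_variableChange`, `analyticRank_smul`, `not_hasCM_variableChange`);
  (⇐) a surjective `ρ̄_{E,p}` at a good ordinary `p ≥ 5` excludes CM
  (`not_hasCM_of_hasSurjectiveModNGaloisRep_of_five_le`, Serre 1972 §4.5).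
* `selmerRankUB_iff_noExcessRankNonCM` — hence, granting the GZK cell and the Ш-half (both carried
  by existing items / named facts on every wanting route), the crux ⟺ `NoExcessRankNonCM`;
  unconditionally the crux IMPLIES it (`noExcessRankNonCM_of_selmerRankUB`) and `SqueezeUB` implies
  it (`noExcessRankNonCM_of_squeezeUB`).

This is the kernel-checked content of the leads' verdict `promote-stub stub_noExcessRankBigImage`:
the statement to promote (or to dedup onto stmt-0496) is `NoExcessRankNonCM`, spelled out below as
the right-hand side of the `iff` (no definition is introduced). Sources: Serre, Invent. Math. 15
(1972), §4.2 Thm. 2 and §4.5; Greenberg, LNM 1716 (1999), §1; Silverman, AEC, III.3.1(b),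
VIII.8, App. C §16.
-/

-- D-0017: single-problem summit, so `Summit.BirchSwinnertonDyer.BirchSwinnertonDyer.…` repeats a
-- namespace BY DESIGN.
set_option linter.dupNamespace false

namespace Summit.BirchSwinnertonDyer.BirchSwinnertonDyer.Theorems

open Summit.BirchSwinnertonDyer.BirchSwinnertonDyer.Theses
open Literature.NumberTheory.EllipticCurves

/-- **Stub ⇒ no excess rank on GLOBALLY MINIMAL non-CM curves**: a non-CM curve has a good ordinary
prime `p ≥ 5` with surjective `ρ̄_{E,p}` (`exists_goodOrdinary_surjective_of_not_hasCM`: Serre's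
open image theorem + infinitely many good ordinary primes, both proved in the tree); apply the stub
there and forget the prime. [cite: Serre1972, §4.2 Théorème 2] -/
theorem noExcessRankNonCM_minimal_of_noExcessRankBigImage
    (h : ∀ (W : WeierstrassCurve ℚ) [W.IsElliptic] [W.IsGloballyMinimal] (p : ℕ) [Fact p.Prime],
        5 ≤ p → W.HasGoodReductionAtPrime p → ¬ (p : ℤ) ∣ W.frobeniusTrace p →
          W.HasSurjectiveModNGaloisRep p → 2 ≤ W.analyticRank →
            W.mordellWeilRank ≤ W.analyticRank) :
    ∀ (W : WeierstrassCurve ℚ) [W.IsElliptic] [W.IsGloballyMinimal], ¬ W.HasCM →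
      2 ≤ W.analyticRank → W.mordellWeilRank ≤ W.analyticRank := by
  intro W _ _ hW h2
  obtain ⟨p, hp, h5, hgood, hord, hsurj⟩ := exists_goodOrdinary_surjective_of_not_hasCM W hW
  exact h W p h5 hgood hord hsurj h2

/-- **Stub ⇒ `NoExcessRankNonCM`** (no global-minimality binder): pass to a global minimal model
`C • W` (`hasGlobalMinimalModel_rat_holds`); `rank`, `r_an` and `¬ CM` are invariant under the
admissible change of variables `C` (`VariableChange.finrank_point_variableChange`,
`analyticRank_smul`, `not_hasCM_variableChange`). [cite: SilvermanAEC2009, VIII.8 and App. C §16] -/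
theorem noExcessRankNonCM_of_noExcessRankBigImage
    (h : ∀ (W : WeierstrassCurve ℚ) [W.IsElliptic] [W.IsGloballyMinimal] (p : ℕ) [Fact p.Prime],
        5 ≤ p → W.HasGoodReductionAtPrime p → ¬ (p : ℤ) ∣ W.frobeniusTrace p →
          W.HasSurjectiveModNGaloisRep p → 2 ≤ W.analyticRank →
            W.mordellWeilRank ≤ W.analyticRank) :
    ∀ (W : WeierstrassCurve ℚ) [W.IsElliptic], ¬ W.HasCM → 2 ≤ W.analyticRank →
      W.mordellWeilRank ≤ W.analyticRank := by
  intro W _ hW h2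
  obtain ⟨C, hC⟩ := WeierstrassCurve.hasGlobalMinimalModel_rat_holds W
  have hMW : (C • W).mordellWeilRank = W.mordellWeilRank :=
    @WeierstrassCurve.VariableChange.finrank_point_variableChange ℚ _ W C (Classical.decEq ℚ)
  have hAn : (C • W).analyticRank = W.analyticRank := WeierstrassCurve.analyticRank_smul W C
  have hmin := noExcessRankNonCM_minimal_of_noExcessRankBigImage h (C • W)
    (not_hasCM_variableChange W C hW) (by rw [hAn]; exact h2)
  rwa [hMW, hAn] at hmin

/-- **`NoExcessRankNonCM` ⇒ stub**: a surjective `ρ̄_{E,p}` at a good ordinary `p ≥ 5` excludes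
complex multiplication (`not_hasCM_of_hasSurjectiveModNGaloisRep_of_five_le`). [cite: Serre1972, §4.5] -/
theorem noExcessRankBigImage_of_noExcessRankNonCM
    (h : ∀ (W : WeierstrassCurve ℚ) [W.IsElliptic], ¬ W.HasCM → 2 ≤ W.analyticRank →
        W.mordellWeilRank ≤ W.analyticRank) :
    ∀ (W : WeierstrassCurve ℚ) [W.IsElliptic] [W.IsGloballyMinimal] (p : ℕ) [Fact p.Prime],
      5 ≤ p → W.HasGoodReductionAtPrime p → ¬ (p : ℤ) ∣ W.frobeniusTrace p →
        W.HasSurjectiveModNGaloisRep p → 2 ≤ W.analyticRank →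
          W.mordellWeilRank ≤ W.analyticRank :=
  fun W _ _ p _ h5 hgood hord hsurj h2 =>
    h W (not_hasCM_of_hasSurjectiveModNGaloisRep_of_five_le W p h5 hgood hord hsurj) h2

/-- **The registered stub `stub_noExcessRankBigImage` IS "no excess rank on non-CM curves of
analytic rank `≥ 2`"** — prime-free and model-free: the prime hypotheses and global minimality are
decoration. This right-hand side is the statement to promote / to dedup onto stmt-0496
(`SqueezeUB` restricted to non-CM curves). [cite: Serre1972, §4.2 Théorème 2 and §4.5] -/
theorem noExcessRankBigImage_iff_noExcessRankNonCM :
    (∀ (W : WeierstrassCurve ℚ) [W.IsElliptic] [W.IsGloballyMinimal] (p : ℕ) [Fact p.Prime],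
        5 ≤ p → W.HasGoodReductionAtPrime p → ¬ (p : ℤ) ∣ W.frobeniusTrace p →
          W.HasSurjectiveModNGaloisRep p → 2 ≤ W.analyticRank →
            W.mordellWeilRank ≤ W.analyticRank) ↔
      ∀ (W : WeierstrassCurve ℚ) [W.IsElliptic], ¬ W.HasCM → 2 ≤ W.analyticRank →
        W.mordellWeilRank ≤ W.analyticRank :=
  ⟨noExcessRankNonCM_of_noExcessRankBigImage, noExcessRankBigImage_of_noExcessRankNonCM⟩

/-- `SqueezeUB` (stmt-0496 / 0145: `∀ W elliptic, rank ≤ r_an`) gives `NoExcessRankNonCM` by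
restriction. [folklore] -/
theorem noExcessRankNonCM_of_squeezeUB (h : Squeeze.SqueezeUB) :
    ∀ (W : WeierstrassCurve ℚ) [W.IsElliptic], ¬ W.HasCM → 2 ≤ W.analyticRank →
      W.mordellWeilRank ≤ W.analyticRank :=
  fun W _ _ _ => h W

/-- **The crux returns `NoExcessRankNonCM` unconditionally**: `SelmerRankUB ⇒` no excess rank on
every non-CM elliptic curve over `ℚ` of analytic rank `≥ 2` (any model). [cite: GreenbergLNM1716, §1] -/
theorem noExcessRankNonCM_of_selmerRankUB
    (hUB : Summit.BirchSwinnertonDyer.BirchSwinnertonDyer.Theses.ShadowIsolation.SelmerRankUB) :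
    ∀ (W : WeierstrassCurve ℚ) [W.IsElliptic], ¬ W.HasCM → 2 ≤ W.analyticRank →
      W.mordellWeilRank ≤ W.analyticRank :=
  noExcessRankNonCM_of_noExcessRankBigImage (noExcessRankBigImage_of_selmerRankUB hUB)

/-- **Exactness, prime-free form.** Granting the GZK-Selmer cell (`r_an ≤ 1 ⇒ corank_p ≤ r_an`,
literature debt behind `rank_eq_analyticRank_of_analyticRank_le_one`) and the Ш-half (carried on
every wanting route by its own items), the crux `SelmerRankUB` is EQUIVALENT to
`NoExcessRankNonCM`. [cite: GreenbergLNM1716, §1] -/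
theorem selmerRankUB_iff_noExcessRankNonCM
    (hGZK : ∀ (W : WeierstrassCurve ℚ) [W.IsElliptic] (p : ℕ) [Fact p.Prime],
        W.analyticRank ≤ 1 → W.selmerCorank p ≤ W.analyticRank)
    (hSha : ∀ (W : WeierstrassCurve ℚ) [W.IsElliptic] [W.IsGloballyMinimal] (p : ℕ) [Fact p.Prime],
        5 ≤ p → W.HasGoodReductionAtPrime p → ¬ (p : ℤ) ∣ W.frobeniusTrace p →
          W.HasSurjectiveModNGaloisRep p → 2 ≤ W.analyticRank → W.shaCorank p = 0) :
    Summit.BirchSwinnertonDyer.BirchSwinnertonDyer.Theses.ShadowIsolation.SelmerRankUB ↔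
      ∀ (W : WeierstrassCurve ℚ) [W.IsElliptic], ¬ W.HasCM → 2 ≤ W.analyticRank →
        W.mordellWeilRank ≤ W.analyticRank :=
  (selmerRankUB_iff_noExcessRankBigImage hGZK hSha).trans noExcessRankBigImage_iff_noExcessRankNonCM

/-- **Net debt, prime-free form, route ShadowIsolation** (every hypothesis but the last is a
registered item; the last is `NoExcessRankNonCM`): `IsolationOfAccidentalZeros`, `PhantomShadow`,
`RankLeOne` and no excess rank on non-CM curves of analytic rank `≥ 2` give the crux. [folklore] -/
theorem selmerRankUB_of_isolation_of_shadow_of_noExcessRankNonCM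
    (hIso : ShadowIsolation.IsolationOfAccidentalZeros) (hSh : ShadowIsolation.PhantomShadow)
    (hR1 : TangentCone.RankLeOne)
    (hNE : ∀ (W : WeierstrassCurve ℚ) [W.IsElliptic], ¬ W.HasCM → 2 ≤ W.analyticRank →
        W.mordellWeilRank ≤ W.analyticRank) :
    Summit.BirchSwinnertonDyer.BirchSwinnertonDyer.Theses.ShadowIsolation.SelmerRankUB :=
  selmerRankUB_of_greenbergSplit (gzkSelmerCell_of_rankLeOne hR1)
    (noExcessRankBigImage_of_noExcessRankNonCM hNE)
    (shaCotorsionBigImage_of_isolation_of_shadow hIso hSh)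

end Summit.BirchSwinnertonDyer.BirchSwinnertonDyer.Theorems
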